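import Summits.Ventures.PercRepro.ProfilePointedCircuitClassesSevenA

/-!
# PercRepro — THE IN–OUT INEQUALITY AT `ρ = 7`, II: THE `7`-POINT SPANNING SETS WITH A PARALLEL CLASS
(p5, gen 41; `proofs/P5-GM1.md` §61)

The two remaining cases of `30 ≤ 3·σ₅(B) + 2·q(B)` for a spanning `7`-set `B` of a loopless rank-`4` matroid
(`σ₅` = spanning `5`-subsets, `q` = parallel pairs with spanning complement): a parallel class of exactly three
points `{p, p', p''}` gives `σ₅(B) ≥ 9` (labels of `S := B ∖ {p', p''}` and `Y := {p', p''}`: `a(p') ≥ 3`,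
`a(p'') ≥ 3`, and the two labels `{p, f}` of `Y` read off the labels `f` of `p'`) and `q(B) ≥ 3`
(`nine_le_card_spanning_five_of_triple`); four pairwise parallel points `P` give `σ₅(B) ≥ 6` (the sets
`(B ∖ P) ∪ Y`, `Y ∈ C(P, 2)`) and `q(B) ≥ 6` (`six_le_card_spanning_five_of_quad`).  With part I:
**`thirty_le_three_mul_card_add_two_mul_card`**.
-/

open scoped Matroid

namespace PercRepro.Cogirth

open Finset ThmH Skew Shadow Profile

variable {α : Type} [DecidableEq α] {M : Matroid α} [M.Finite]

section SevenB

/-- A parallel class collapses to one of its points: `ρ(F ∪ P) = ρ(F + p)` for `p ∈ P`, `ρ(P) ≤ 1`. -/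
theorem rk_union_eq_rk_insert_of_parallel_class (hll : ∀ x ∈ gr M, rk M {x} = 1) {P F : Finset α}
    (hP : P ⊆ gr M) (hF : F ⊆ gr M) {p : α} (hp : p ∈ P) (hPpar : rk M P ≤ 1) :
    rk M (F ∪ P) = rk M (insert p F) := by
  apply le_antisymm
  · apply rk_le_rk_of_subset_clF
    have hpcl : P ⊆ clF M {p} := by
      apply subset_clF_of_rk_le_rk (singleton_subset_iff.2 hp) hP
      rw [hll p (hP hp)]
      exact hPpar
    intro x hx
    rw [mem_union] at hx
    rcases hx with hx | hx
    · exact mem_clF_of_mem_of_subset_gr (insert_subset (hP hp) hF) (mem_insert_of_mem hx)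
    · exact mem_clF_of_subset (singleton_subset_iff.2 (mem_insert_self p F)) (hpcl hx)
  · exact rk_mono' (insert_subset (mem_union_right F hp) subset_union_left)

/-- Parallelism is transitive: `ρ{b, a} ≤ 1`, `ρ{b, c} ≤ 1` ⟹ `ρ{a, c} ≤ 1` (`b` not a loop). -/
theorem rk_pair_le_one_trans (hll : ∀ x ∈ gr M, rk M {x} = 1) {a b c : α} (hb : b ∈ gr M)
    (h1 : rk M {b, a} ≤ 1) (h2 : rk M {b, c} ≤ 1) : rk M {a, c} ≤ 1 := by
  have h := rk_triple_le_one_of_parallel hll hb h1 h2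
  have hsub : ({a, c} : Finset α) ⊆ {b, a, c} := by
    intro x hx
    rw [mem_insert, mem_singleton] at hx
    rw [mem_insert, mem_insert, mem_singleton]
    tauto
  exact (rk_mono' (M := M) hsub).trans h

/-- **Case 2: a parallel class of exactly three points — `σ₅(B) ≥ 9` and `q(B) ≥ 3`.** -/
theorem nine_le_card_spanning_five_of_triple (hR : rk M (gr M) = 4) (hll : ∀ x ∈ gr M, rk M {x} = 1)
    {B : Finset α} (hB : B ⊆ gr M) (hB7 : B.card = 7) (hBsp : rk M B = 4) {p p' p'' : α} (hp : p ∈ B)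
    (hp' : p' ∈ B) (hp'' : p'' ∈ B) (hpp' : p ≠ p') (hpp'' : p ≠ p'') (hp'p'' : p' ≠ p'')
    (hpar : rk M {p, p', p''} ≤ 1) (hno4 : ∀ x ∈ B, x ∉ ({p, p', p''} : Finset α) → ¬ rk M {p, x} ≤ 1) :
    9 ≤ ((B.powersetCard 5).filter (fun X => rk M X = 4)).card ∧
      3 ≤ ((B.powersetCard 2).filter (fun Y => rk M Y ≤ 1 ∧ rk M (B \ Y) = 4)).card := by
  have hPg : ({p, p', p''} : Finset α) ⊆ gr M := by
    intro x hx
    rw [mem_insert, mem_insert, mem_singleton] at hx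
    rcases hx with h | h | h <;> rw [h] <;> exact hB ‹_›
  have hpp'1 : rk M {p, p'} ≤ 1 := (rk_mono' (M := M) (insert_subset_insert _ (singleton_subset_iff.2
    (mem_insert_self _ _)))).trans hpar
  have hpp''1 : rk M {p, p''} ≤ 1 := (rk_mono' (M := M) (insert_subset_insert _ (singleton_subset_iff.2
    (mem_insert_of_mem (mem_singleton_self _))))).trans hpar
  -- `F := B ∖ {p, p', p''}`, `S := F + p`, `Y := {p', p''}`
  set F := B \ {p, p', p''} with hFdef
  have hFg : F ⊆ gr M := sdiff_subset.trans hB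
  have hF4 : F.card = 4 := by
    rw [hFdef, card_sdiff_of_subset (by
      intro x hx
      rw [mem_insert, mem_insert, mem_singleton] at hx
      rcases hx with h | h | h <;> rw [h] <;> assumption), hB7, card_insert_of_notMem, card_pair hp'p'']
    rw [mem_insert, mem_singleton, not_or]
    exact ⟨hpp', hpp''⟩
  have hpF : p ∉ F := fun h => (mem_sdiff.1 h).2 (mem_insert_self _ _)
  have hp'F : p' ∉ F := fun h => (mem_sdiff.1 h).2 (mem_insert_of_mem (mem_insert_self _ _))
  have hp''F : p'' ∉ F := fun h => (mem_sdiff.1 h).2 (mem_insert_of_mem (mem_insert_of_mem (mem_singleton_self _)))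
  have hBeq : B = F ∪ {p, p', p''} := by
    rw [hFdef]
    ext x
    simp only [mem_union, mem_sdiff, mem_insert, mem_singleton]
    constructor
    · intro hx
      by_cases h : x = p ∨ x = p' ∨ x = p''
      · exact Or.inr h
      · exact Or.inl ⟨hx, h⟩
    · rintro (⟨hx, _⟩ | h | h | h)
      · exact hx
      · rw [h]; exact hp
      · rw [h]; exact hp'
      · rw [h]; exact hp''
  have hSsp : rk M (insert p F) = 4 := by
    rw [← rk_union_eq_rk_insert_of_parallel_class hll hPg hFg (mem_insert_self _ _) hpar, ← hBeq]
    exact hBsp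
  have hS5 : (insert p F).card = 5 := by rw [card_insert_of_notMem hpF, hF4]
  have hSg : insert p F ⊆ gr M := insert_subset (hB hp) hFg
  have hSY : Disjoint (insert p F) {p', p''} := by
    rw [disjoint_left]
    intro x hx hxY
    rw [mem_insert] at hx
    rw [mem_insert, mem_singleton] at hxY
    rcases hxY with h | h <;> rw [h] at hx <;> rcases hx with h' | h'
    · exact hpp' h'.symm
    · exact hp'F h'
    · exact hpp'' h'.symm
    · exact hp''F h'
  have hSdef : B = insert p F ∪ {p', p''} := by
    rw [hBeq]
    ext x
    simp only [mem_union, mem_insert, mem_singleton]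
    tauto
  have hmain := one_add_sum_add_le_card_spanning_five_of_card_two (M := M) hS5 hSsp hSY (card_pair hp'p'')
  rw [← hSdef] at hmain
  -- no point of `Y` is parallel to a parallel pair of `S`
  have hnp : ∀ w ∈ ({p', p''} : Finset α), ∀ t ∈ insert p F, ∀ t' ∈ insert p F, t ≠ t' →
      rk M {t, t'} ≤ 1 → ¬ rk M {t, w} ≤ 1 := by
    intro w hw t ht t' ht' htt' hpar' htw
    have hwp : rk M {p, w} ≤ 1 := by
      rw [mem_insert, mem_singleton] at hw
      rcases hw with h | h <;> rw [h] <;> assumption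
    have hptw : rk M {p, t} ≤ 1 := by
      have hwg : w ∈ gr M := by
        rw [mem_insert, mem_singleton] at hw
        rcases hw with h | h <;> rw [h]
        · exact hB hp'
        · exact hB hp''
      have := rk_pair_le_one_trans hll hwg (by rw [pair_comm]; exact hwp) (by rw [pair_comm]; exact htw)
      exact this
    rw [mem_insert] at ht ht'
    rcases ht with h | h
    · -- `t = p`: then `t' ∈ F` is parallel to `p`
      rcases ht' with h' | h'
      · exact htt' (h.trans h'.symm)
      · have hpt' : rk M {p, t'} ≤ 1 := by rw [← h]; exact hpar'
        exact hno4 t' (mem_sdiff.1 h').1 (mem_sdiff.1 h').2 hpt'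
    · exact hno4 t (mem_sdiff.1 h).1 (mem_sdiff.1 h).2 hptw
  have hap' : 3 ≤ ((insert p F).filter (fun s => rk M (insert p' ((insert p F).erase s)) = 4)).card :=
    three_le_card_filter_of_not_parallel hR hll hSg hS5 hSsp (hB hp') (fun h => disjoint_left.1 hSY h
      (mem_insert_self _ _)) (hnp p' (mem_insert_self _ _))
  have hap'' : 3 ≤ ((insert p F).filter (fun s => rk M (insert p'' ((insert p F).erase s)) = 4)).card :=
    three_le_card_filter_of_not_parallel hR hll hSg hS5 hSsp (hB hp'') (fun h => disjoint_left.1 hSY h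
      (mem_insert_of_mem (mem_singleton_self _))) (hnp p'' (mem_insert_of_mem (mem_singleton_self _)))
  have hsum : 6 ≤ ∑ w ∈ ({p', p''} : Finset α),
      ((insert p F).filter (fun s => rk M (insert w ((insert p F).erase s)) = 4)).card := by
    rw [sum_pair hp'p'']
    omega
  -- the two labels `{p, f}` of `Y`, `f` a label of `p'` inside `F`
  have hg : 2 ≤ (((insert p F).powersetCard 2).filter
      (fun A => rk M ((insert p F \ A) ∪ {p', p''}) = 4)).card := by
    set L := (insert p F).filter (fun s => rk M (insert p' ((insert p F).erase s)) = 4) with hLdef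
    have hL2 : 2 ≤ (L.erase p).card := by
      have := card_erase_of_mem (s := L) (a := p)
      by_cases hpL : p ∈ L
      · rw [card_erase_of_mem hpL]; omega
      · rw [erase_eq_of_notMem hpL]; omega
    have hsub : (L.erase p).image (fun f => ({p, f} : Finset α)) ⊆ ((insert p F).powersetCard 2).filter
        (fun A => rk M ((insert p F \ A) ∪ {p', p''}) = 4) := by
      intro A hA
      rw [mem_image] at hA
      obtain ⟨f, hf, rfl⟩ := hA
      have hfp : f ≠ p := ne_of_mem_erase hf
      have hfL := mem_of_mem_erase hf
      rw [hLdef, mem_filter, mem_insert] at hfL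
      have hfF : f ∈ F := by
        rcases hfL.1 with h | h
        · exact absurd h hfp
        · exact h
      rw [mem_filter, mem_powersetCard]
      refine ⟨⟨insert_subset (mem_insert_self _ _) (singleton_subset_iff.2 (mem_insert_of_mem hfF)),
        card_pair hfp.symm⟩, ?_⟩
      -- `ρ(F − f + p) = 4` from the label
      have e1 : (insert p F).erase f = insert p (F.erase f) := erase_insert_of_ne hfp.symm
      have h4 : rk M (insert p (F.erase f)) = 4 := by
        have h := hfL.2
        rw [e1, rk_insert_insert_eq_of_parallel hll (hB hp) (by rw [pair_comm]; exact hpp'1)] at h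
        exact h
      have e2 : (insert p F \ {p, f}) ∪ {p', p''} = insert p' (insert p'' (F.erase f)) := by
        ext x
        simp only [mem_union, mem_sdiff, mem_insert, mem_singleton, mem_erase, not_or]
        constructor
        · rintro (⟨h | h, h1, h2⟩ | h | h)
          · exact absurd h h1
          · exact Or.inr (Or.inr ⟨h2, h⟩)
          · exact Or.inl h
          · exact Or.inr (Or.inl h)
        · rintro (h | h | ⟨h1, h2⟩)
          · exact Or.inr (Or.inl h)
          · exact Or.inr (Or.inr h)
          · refine Or.inl ⟨Or.inr h2, fun h => hpF (h ▸ h2), h1⟩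
      rw [e2, rk_insert_eq_of_parallel hll (hB hp') (hB hp) (by rw [pair_comm]; exact hpp'1)
        (insert_subset (hB hp'') ((erase_subset _ _).trans hFg)), insert_comm,
        rk_insert_eq_of_parallel hll (hB hp'') (hB hp) (by rw [pair_comm]; exact hpp''1)
          (insert_subset (hB hp) ((erase_subset _ _).trans hFg)),
        insert_eq_of_mem (mem_insert_self p (F.erase f))]
      exact h4
    have hcard : ((L.erase p).image (fun f => ({p, f} : Finset α))).card = (L.erase p).card := by
      apply card_image_of_injOn
      intro f hf f' hf' hff'
      simp only at hff'
      have : f ∈ ({p, f'} : Finset α) := by rw [← hff']; exact mem_insert_of_mem (mem_singleton_self _)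
      rw [mem_insert, mem_singleton] at this
      rcases this with h | h
      · exact absurd h (ne_of_mem_erase hf)
      · exact h
    calc 2 ≤ (L.erase p).card := hL2
      _ = _ := hcard.symm
      _ ≤ _ := card_le_card hsub
  refine ⟨by omega, ?_⟩
  -- `q ≥ 3`: the three pairs of the class
  have hsubq : ({p, p', p''} : Finset α).powersetCard 2 ⊆
      (B.powersetCard 2).filter (fun Y => rk M Y ≤ 1 ∧ rk M (B \ Y) = 4) := by
    intro Y hY
    rw [mem_powersetCard] at hY
    rw [mem_filter, mem_powersetCard]
    refine ⟨⟨hY.1.trans (by rw [hBeq]; exact subset_union_right), hY.2⟩, (rk_mono' hY.1).trans hpar, ?_⟩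
    -- the third point `x` of the class lies in `B ∖ Y`
    have hx : (({p, p', p''} : Finset α) \ Y).card = 1 := by
      rw [card_sdiff_of_subset hY.1, hY.2, card_insert_of_notMem, card_pair hp'p'']
      rw [mem_insert, mem_singleton, not_or]
      exact ⟨hpp', hpp''⟩
    obtain ⟨x, hxeq⟩ := card_eq_one.1 hx
    have hxmem : x ∈ ({p, p', p''} : Finset α) \ Y := by rw [hxeq]; exact mem_singleton_self x
    rw [mem_sdiff] at hxmem
    have hxp : rk M {p, x} ≤ 1 := (rk_mono' (M := M) (insert_subset (mem_insert_self _ _)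
      (singleton_subset_iff.2 hxmem.1))).trans hpar
    have hsub' : insert x F ⊆ B \ Y := by
      intro g hg
      rw [mem_insert] at hg
      rw [mem_sdiff]
      rcases hg with h | h
      · rw [h]; exact ⟨hPg hxmem.1 |> fun _ => (by rw [hBeq]; exact mem_union_right _ hxmem.1), hxmem.2⟩
      · exact ⟨(mem_sdiff.1 h).1, fun hgY => (mem_sdiff.1 h).2 (hY.1 hgY)⟩
    have h1 := rk_mono' (M := M) hsub'
    have h2 : rk M (insert x F) = rk M (insert p F) :=
      rk_insert_eq_of_parallel hll (hPg hxmem.1) (hB hp) (by rw [pair_comm]; exact hxp) hFg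
    have h3 : rk M (B \ Y) ≤ rk M (gr M) := rk_le_rk_gr ((sdiff_subset (s := B) (t := Y)).trans hB)
    omega
  have hc3 : ({p, p', p''} : Finset α).card = 3 := by
    rw [card_insert_of_notMem, card_pair hp'p'']
    rw [mem_insert, mem_singleton, not_or]
    exact ⟨hpp', hpp''⟩
  have h32 : Nat.choose 3 2 = 3 := by decide
  calc 3 = (({p, p', p''} : Finset α).powersetCard 2).card := by rw [card_powersetCard, hc3, h32]
    _ ≤ _ := card_le_card hsubq

/-- **Case 3: four pairwise parallel points — `σ₅(B) ≥ 6` and `q(B) ≥ 6`.** -/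
theorem six_le_card_spanning_five_of_quad (hR : rk M (gr M) = 4) (hll : ∀ x ∈ gr M, rk M {x} = 1)
    {B : Finset α} (hB : B ⊆ gr M) (hB7 : B.card = 7) (hBsp : rk M B = 4) {P : Finset α} (hPB : P ⊆ B)
    (hP4 : P.card = 4) (hPpar : rk M P ≤ 1) :
    6 ≤ ((B.powersetCard 5).filter (fun X => rk M X = 4)).card ∧
      6 ≤ ((B.powersetCard 2).filter (fun Y => rk M Y ≤ 1 ∧ rk M (B \ Y) = 4)).card := by
  have hPg : P ⊆ gr M := hPB.trans hB
  set F := B \ P with hFdef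
  have hFg : F ⊆ gr M := sdiff_subset.trans hB
  have hF3 : F.card = 3 := by rw [hFdef, card_sdiff_of_subset hPB, hB7, hP4]
  have hBeq : B = F ∪ P := by rw [hFdef]; exact (sdiff_union_of_subset hPB).symm
  have hFP : Disjoint F P := by rw [hFdef]; exact sdiff_disjoint
  obtain ⟨p, hp⟩ : P.Nonempty := by rw [← card_pos, hP4]; omega
  have hpF : rk M (insert p F) = 4 := by
    rw [← rk_union_eq_rk_insert_of_parallel_class hll hPg hFg hp hPpar, ← hBeq]
    exact hBsp
  -- every point of `P` substitutes for `p`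
  have hins : ∀ y ∈ P, rk M (insert y F) = 4 := by
    intro y hy
    rw [rk_insert_eq_of_parallel hll (hPg hy) (hPg hp)
      ((rk_mono' (M := M) (insert_subset hy (singleton_subset_iff.2 hp))).trans hPpar) hFg]
    exact hpF
  constructor
  · -- the six sets `F ∪ Y`
    have hsub : (P.powersetCard 2).image (fun Y => F ∪ Y) ⊆ (B.powersetCard 5).filter (fun X => rk M X = 4) := by
      intro X hX
      rw [mem_image] at hX
      obtain ⟨Y, hY, rfl⟩ := hX
      rw [mem_powersetCard] at hY
      rw [mem_filter, mem_powersetCard]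
      refine ⟨⟨by rw [hBeq]; exact union_subset_union (Subset.refl F) hY.1, ?_⟩, ?_⟩
      · rw [card_union_of_disjoint (hFP.mono_right hY.1), hF3, hY.2]
      · obtain ⟨y, hy⟩ : Y.Nonempty := by rw [← card_pos, hY.2]; omega
        have h1 : rk M (F ∪ Y) = rk M (insert y F) :=
          rk_union_eq_rk_insert_of_parallel_class hll (hY.1.trans hPg) hFg hy ((rk_mono' hY.1).trans hPpar)
        rw [h1]
        exact hins y (hY.1 hy)
    have h42 : Nat.choose 4 2 = 6 := by decide
    have hcard : ((P.powersetCard 2).image (fun Y => F ∪ Y)).card = 6 := by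
      rw [card_image_of_injOn, card_powersetCard, hP4, h42]
      intro Y hY Y' hY' h
      rw [mem_coe, mem_powersetCard] at hY hY'
      simp only at h
      have e : ∀ Z ⊆ P, (F ∪ Z) ∩ P = Z := by
        intro Z hZ
        rw [union_inter_distrib_right, inter_eq_left.2 hZ, disjoint_iff_inter_eq_empty.1 hFP, empty_union]
      rw [← e Y hY.1, ← e Y' hY'.1, h]
    calc 6 = _ := hcard.symm
      _ ≤ _ := card_le_card hsub
  · -- the six pairs of `P`
    have hsub : P.powersetCard 2 ⊆ (B.powersetCard 2).filter (fun Y => rk M Y ≤ 1 ∧ rk M (B \ Y) = 4) := by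
      intro Y hY
      rw [mem_powersetCard] at hY
      rw [mem_filter, mem_powersetCard]
      refine ⟨⟨hY.1.trans hPB, hY.2⟩, (rk_mono' hY.1).trans hPpar, ?_⟩
      obtain ⟨x, hx⟩ : (P \ Y).Nonempty := by
        rw [← card_pos, card_sdiff_of_subset hY.1, hP4, hY.2]; omega
      rw [mem_sdiff] at hx
      have hsub' : insert x F ⊆ B \ Y := by
        intro g hg
        rw [mem_insert] at hg
        rw [mem_sdiff]
        rcases hg with h | h
        · rw [h]; exact ⟨hPB hx.1, hx.2⟩
        · exact ⟨(mem_sdiff.1 h).1, fun hgY => (mem_sdiff.1 h).2 (hY.1 hgY)⟩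
      have h1 := rk_mono' (M := M) hsub'
      have h2 := hins x hx.1
      have h3 : rk M (B \ Y) ≤ rk M (gr M) := rk_le_rk_gr ((sdiff_subset (s := B) (t := Y)).trans hB)
      omega
    have h42 : Nat.choose 4 2 = 6 := by decide
    calc 6 = (P.powersetCard 2).card := by rw [card_powersetCard, hP4, h42]
      _ ≤ _ := card_le_card hsub

/-- **THE CLASSIFICATION**: for a spanning `7`-set `B` of a loopless rank-`4` matroid,
`30 ≤ 3·σ₅(B) + 2·q(B)`. -/
theorem thirty_le_three_mul_card_add_two_mul_card (hR : rk M (gr M) = 4) (hll : ∀ x ∈ gr M, rk M {x} = 1)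
    {B : Finset α} (hB : B ⊆ gr M) (hB7 : B.card = 7) (hBsp : rk M B = 4) :
    30 ≤ 3 * ((B.powersetCard 5).filter (fun X => rk M X = 4)).card +
      2 * ((B.powersetCard 2).filter (fun Y => rk M Y ≤ 1 ∧ rk M (B \ Y) = 4)).card := by
  by_cases h4 : ∃ P ∈ B.powersetCard 4, rk M P ≤ 1
  · obtain ⟨P, hP, hPpar⟩ := h4
    rw [mem_powersetCard] at hP
    have := six_le_card_spanning_five_of_quad hR hll hB hB7 hBsp hP.1 hP.2 hPpar
    omega
  · simp only [not_exists, not_and] at h4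
    by_cases h3 : ∃ Z ∈ B.powersetCard 3, rk M Z ≤ 1
    · obtain ⟨Z, hZ, hZpar⟩ := h3
      rw [mem_powersetCard] at hZ
      obtain ⟨p, p', p'', hpp', hpp'', hp'p'', hZeq⟩ := card_eq_three.1 hZ.2
      rw [hZeq] at hZ hZpar
      have hp : p ∈ B := hZ.1 (mem_insert_self _ _)
      have hp' : p' ∈ B := hZ.1 (mem_insert_of_mem (mem_insert_self _ _))
      have hp'' : p'' ∈ B := hZ.1 (mem_insert_of_mem (mem_insert_of_mem (mem_singleton_self _)))
      have hno4 : ∀ x ∈ B, x ∉ ({p, p', p''} : Finset α) → ¬ rk M {p, x} ≤ 1 := by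
        intro x hxB hxZ hpx
        apply h4 (insert x {p, p', p''})
        · rw [mem_powersetCard]
          refine ⟨insert_subset hxB hZ.1, ?_⟩
          rw [card_insert_of_notMem hxZ, card_insert_of_notMem, card_pair hp'p'']
          rw [mem_insert, mem_singleton, not_or]
          exact ⟨hpp', hpp''⟩
        · -- `ρ(Z + x) ≤ ρ(Z) + ρ{p, x} − ρ{p} ≤ 1`
          have h := rk_union_add_rk_inter_le (M := M) {p, p', p''} {p, x}
          have hu : ({p, p', p''} : Finset α) ∪ {p, x} = insert x {p, p', p''} := by
            ext g
            simp only [mem_union, mem_insert, mem_singleton]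
            tauto
          have hi : ({p} : Finset α) ⊆ ({p, p', p''} : Finset α) ∩ {p, x} := by
            intro g hg
            rw [mem_singleton] at hg
            subst hg
            exact mem_inter.2 ⟨mem_insert_self _ _, mem_insert_self _ _⟩
          have h1 := rk_mono' (M := M) hi
          rw [hll p (hB hp)] at h1
          rw [hu] at h
          omega
      have := nine_le_card_spanning_five_of_triple hR hll hB hB7 hBsp hp hp' hp'' hpp' hpp'' hp'p'' hZpar hno4
      omega
    · simp only [not_exists, not_and] at h3
      have := ten_le_card_spanning_five_of_no_triple hR hll hB hB7 hBsp h3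
      omega

end SevenB

end PercRepro.Cogirth
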